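import Summits.QuantumFields.YangMills.Theses.EquipartitionCriticality
import Summits.QuantumFields.YangMills.Theorems.EquipartitionCriticalityEquipartitionPinsProbeEquipartition
import Summits.QuantumFields.YangMills.Theorems.EquipartitionCriticalityEquipartitionPinsProbeGaussianProfile
import Summits.QuantumFields.YangMills.Theorems.EquipartitionCriticalityEquipartitionPinsProbePoissonIntegral
import Summits.QuantumFields.YangMills.Theorems.EquipartitionCriticalityEquipartitionPinsProbeAxisFourier
import Summits.QuantumFields.YangMills.Theorems.EquipartitionCriticalityEquipartitionPinsProbeProfile
import Summits.QuantumFields.YangMills.Theorems.EquipartitionCriticalityEquipartitionPinsProbeSecondDifference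
import Literature.MathematicalPhysics.QuantumFieldTheory.CurvatureGaussianField
import HarnessLib

/-!
# Reduction of the crux `EquipartitionPinsProbe` to the local free-gluon law (line `Sketch`)

Route `EquipartitionCriticality` of `YangMills`, crux item `stmt-QuantumFields-8760`
(`Summit.QuantumFields.YangMills.Theses.EquipartitionCriticality.EquipartitionPinsProbe`), line
`Sketch` of the lead prover.

What is proved (`equipartitionPinsProbe_of_localLaw`): the crux follows from ONE statement, the
registered stub `stub_localLaw` of the line — the local free-gluon law in its gauge-invariant
two-plaquette shadow: uniform equipartition of the plaquette energy over torus-limit states forces,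
for some `D ≥ 1`, the time-covariances of the probe `exp(−2β(N − Re tr r(U_p)))` to converge,
uniformly over torus-limit states, to the covariance of `e^{−|Y_{p₀}|²}` and `e^{−|Y_{p_n}|²}` under
the curvature Gaussian field `curvatureGaussianField 4 D`. Everything else of the line is landed:
`stub_equipartition` (Griffiths + subgradient squeeze: the free-energy hypothesis gives the uniform
equipartition), `stub_gaussianProfile` (that Gaussian covariance is
`g_D(n) = 2^{−D}((1 − c_n²)^{−D/2} − 1)`), `stub_secondDifference`, `stub_poissonIntegral`,
`stub_axisFourier`, `stub_profile` (the plaquette two-point numbers `c_n` of the lattice Maxwell field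
are `(2/3)(2π)^{−3} J_{|n|}` with `0 < J_n ≤ (2π)³` and `J_n ≥ C_ε e^{−εn}`). The glue proved here is
elementary real analysis: `0 < c_n ≤ 2/3` (`n ≠ 0`), the Bernoulli-type bound
`(1 − x)^{−a} − 1 ≥ a x`, hence `g_D(n) ≥ 2^{−D}(D/2)c_n²`, and the crux's sub-exponential clause
`∀ m > 0, ∃ s < t, 0 < g(2s) ∧ g(2s)e^{−m(2t−2s)} < g(2t)` (by contradiction: exponential decay at
rate `2m` from `s = 1` against the lower bound `K e^{−mt}`); the probe `φ(x) = e^{−2x₊}` is bounded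
and continuous. No definitions are introduced (the profile is carried as a function `g` with a
defining hypothesis).
-/

noncomputable section

open MeasureTheory Filter Topology
open Literature.MathematicalPhysics.QuantumFieldTheory Literature.Probability.LatticeModels

namespace Summit.QuantumFields.YangMills.Theorems.EquipartitionPinsProbe

namespace Reduction

/-- `3 ≤ 4`. -/
theorem three_le_four : 3 ≤ 4 := by norm_num

/-- `c_n = (2/3)(2π)^{−3} J_{|n|}` for `n ≠ 0` (stubs `stub_secondDifference`, `stub_axisFourier`,
`stub_poissonIntegral`). -/
theorem corr_eq_klIntegral {n : ℤ} (hn : n ≠ 0) :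
    curvaturePlaquetteCorr (d := 4) three_le_four n =
      2 / 3 / (2 * Real.pi) ^ 3 *
        ∫ k in brillouin 3, Real.sqrt (dispersion k / (dispersion k + 2)) *
          (1 + dispersion k - Real.sqrt (dispersion k * (dispersion k + 2))) ^ n.natAbs := by
  have h3 := stub_secondDifference n hn
  have h5 := stub_axisFourier stub_poissonIntegral n hn
  rw [show curvaturePlaquetteCorr (d := 4) three_le_four n =
      curvaturePlaquetteCorr (d := 4) (by norm_num) n from rfl, h3, h5]
  ring

/-- `0 < c_n` for `n ≠ 0`. -/
theorem corr_pos {n : ℤ} (hn : n ≠ 0) : 0 < curvaturePlaquetteCorr (d := 4) three_le_four n := by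
  rw [corr_eq_klIntegral hn]
  have hJ := (stub_profile.1 n.natAbs).1
  have : (0 : ℝ) < 2 / 3 / (2 * Real.pi) ^ 3 := by positivity
  exact mul_pos this hJ

/-- `c_n ≤ 2/3` for `n ≠ 0`. -/
theorem corr_le {n : ℤ} (hn : n ≠ 0) : curvaturePlaquetteCorr (d := 4) three_le_four n ≤ 2 / 3 := by
  rw [corr_eq_klIntegral hn]
  have hJ := (stub_profile.1 n.natAbs).2
  calc 2 / 3 / (2 * Real.pi) ^ 3 * _
      ≤ 2 / 3 / (2 * Real.pi) ^ 3 * (2 * Real.pi) ^ 3 :=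
        mul_le_mul_of_nonneg_left hJ (by positivity)
    _ = 2 / 3 := by field_simp

/-- Sub-exponential lower bound: for every `ε > 0` there is `C > 0` with `C e^{−ε n} ≤ c_n` for all
`n ≥ 1`. -/
theorem corr_subexp {ε : ℝ} (hε : 0 < ε) :
    ∃ C : ℝ, 0 < C ∧ ∀ n : ℕ, n ≠ 0 →
      C * Real.exp (-(ε * n)) ≤ curvaturePlaquetteCorr (d := 4) three_le_four (n : ℤ) := by
  obtain ⟨C, hC, hCn⟩ := stub_profile.2 ε hε
  refine ⟨2 / 3 / (2 * Real.pi) ^ 3 * C, by positivity, fun n hn => ?_⟩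
  have hn' : (n : ℤ) ≠ 0 := by exact_mod_cast hn
  rw [corr_eq_klIntegral hn', Int.natAbs_natCast, mul_assoc]
  exact mul_le_mul_of_nonneg_left (hCn n) (by positivity)

/-- Bernoulli-type lower bound: for `x < 1` and `a ≥ 0`, `(1 − x)^{−a} − 1 ≥ a x`
(`log(1 − x) ≤ −x` and `1 + a x ≤ e^{a x}`). -/
theorem rpow_neg_sub_one_ge {x a : ℝ} (hx1 : x < 1) (ha : 0 ≤ a) :
    a * x ≤ (1 - x) ^ (-a) - 1 := by
  have h1x : 0 < 1 - x := by linarith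
  have hlog : Real.log (1 - x) ≤ -x := by
    have := Real.log_le_sub_one_of_pos h1x
    linarith
  have hexp : Real.exp (a * x) ≤ (1 - x) ^ (-a) := by
    rw [Real.rpow_def_of_pos h1x]
    apply Real.exp_le_exp.2
    nlinarith
  have hlin : a * x + 1 ≤ Real.exp (a * x) := Real.add_one_le_exp _
  linarith

/-- **The sub-exponential clause, abstractly.** If `c : ℕ → ℝ` satisfies `0 < c n ≤ 2/3` for
`n ≠ 0` and the sub-exponential lower bound `c n ≥ C_ε e^{−εn}`, and
`g n = 2^{−D}((1 − (c n)²)^{−D/2} − 1)` with `D ≥ 1`, then for every `m > 0` there are `s < t` with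
`0 < g(2s)` and `g(2s) e^{−m(2t−2s)} < g(2t)`. -/
theorem clause_of_bounds {D : ℕ} (hD : 0 < D) (c g : ℕ → ℝ)
    (hpos : ∀ n, n ≠ 0 → 0 < c n) (hle : ∀ n, n ≠ 0 → c n ≤ 2 / 3)
    (hsub : ∀ ε : ℝ, 0 < ε → ∃ C : ℝ, 0 < C ∧ ∀ n : ℕ, n ≠ 0 → C * Real.exp (-(ε * n)) ≤ c n)
    (hg : ∀ n, g n = (2 : ℝ) ^ (-(D : ℝ)) * ((1 - c n ^ 2) ^ (-((D : ℝ) / 2)) - 1)) :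
    ∀ m : ℝ, 0 < m → ∃ s t : ℕ, s < t ∧ 0 < g (2 * s) ∧
      g (2 * s) * Real.exp (-(m * (2 * (t : ℝ) - 2 * (s : ℝ)))) < g (2 * t) := by
  -- `g n ≥ 2^{-D} (D/2) (c n)²` and `g n > 0` for `n ≠ 0`
  have hge : ∀ n, n ≠ 0 → (2 : ℝ) ^ (-(D : ℝ)) * ((D : ℝ) / 2 * c n ^ 2) ≤ g n := by
    intro n hn
    rw [hg n]
    refine mul_le_mul_of_nonneg_left ?_ (by positivity)
    have hx1 : c n ^ 2 < 1 := by
      have h1 := hpos n hn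
      have h2 := hle n hn
      nlinarith
    have := rpow_neg_sub_one_ge hx1 (a := (D : ℝ) / 2) (by positivity)
    simpa [neg_div] using this
  have hgpos : ∀ n, n ≠ 0 → 0 < g n := by
    intro n hn
    refine lt_of_lt_of_le ?_ (hge n hn)
    have hc := hpos n hn
    have hD' : (0 : ℝ) < D := by exact_mod_cast hD
    positivity
  intro m hm
  by_contra hcon
  push Not at hcon
  obtain ⟨C, hC, hCn⟩ := hsub (m / 4) (by positivity)
  have hg2 : 0 < g (2 * 1) := hgpos _ (by norm_num)
  have hup : ∀ t : ℕ, 1 < t →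
      g (2 * t) ≤ g (2 * 1) * Real.exp (-(m * (2 * (t : ℝ) - 2 * ((1 : ℕ) : ℝ)))) :=
    fun t ht => hcon 1 t ht hg2
  have hlow : ∀ t : ℕ, t ≠ 0 →
      (2 : ℝ) ^ (-(D : ℝ)) * ((D : ℝ) / 2 * (C * Real.exp (-(m / 4 * ((2 * t : ℕ) : ℝ)))) ^ 2) ≤
        g (2 * t) := by
    intro t ht
    have h2t : 2 * t ≠ 0 := by omega
    refine le_trans ?_ (hge _ h2t)
    refine mul_le_mul_of_nonneg_left ?_ (by positivity)
    refine mul_le_mul_of_nonneg_left ?_ (by positivity)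
    have h0 : 0 ≤ C * Real.exp (-(m / 4 * ((2 * t : ℕ) : ℝ))) := by positivity
    exact pow_le_pow_left₀ h0 (hCn (2 * t) h2t) 2
  set K : ℝ := (2 : ℝ) ^ (-(D : ℝ)) * ((D : ℝ) / 2 * C ^ 2) with hK
  have hKpos : 0 < K := by
    have hD' : (0 : ℝ) < D := by exact_mod_cast hD
    positivity
  set P : ℝ := g (2 * 1) with hP
  obtain ⟨t, ht⟩ : ∃ t : ℕ, P * Real.exp (2 * m) / K < Real.exp (m * t) ∧ 1 < t := by
    have htend : Tendsto (fun t : ℕ => Real.exp (m * t)) atTop atTop := by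
      refine Real.tendsto_exp_atTop.comp ?_
      exact Tendsto.const_mul_atTop hm tendsto_natCast_atTop_atTop
    have h1 := htend.eventually_gt_atTop (P * Real.exp (2 * m) / K)
    have h2 := eventually_gt_atTop 1
    exact (h1.and h2).exists
  have ht0 : t ≠ 0 := by omega
  have hl := hlow t ht0
  have hu := hup t ht.2
  have hexp2 : (C * Real.exp (-(m / 4 * ((2 * t : ℕ) : ℝ)))) ^ 2 = C ^ 2 * Real.exp (-(m * t)) := by
    rw [mul_pow, ← Real.exp_nat_mul]
    congr 1
    congr 1
    push_cast
    ring
  rw [hexp2] at hl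
  have hl' : K * Real.exp (-(m * t)) ≤ g (2 * t) := by
    rw [hK]
    convert hl using 1
    ring
  have hu' : g (2 * t) ≤ P * Real.exp (2 * m) * Real.exp (-(2 * m * t)) := by
    rw [hP]
    convert hu using 1
    rw [mul_assoc, ← Real.exp_add]
    congr 1
    congr 1
    push_cast
    ring
  have hchain : K * Real.exp (-(m * t)) ≤ P * Real.exp (2 * m) * Real.exp (-(2 * m * t)) :=
    hl'.trans hu'
  clear_value K P
  have h3 : K * Real.exp (m * t) ≤ P * Real.exp (2 * m) := by
    have hmul := mul_le_mul_of_nonneg_right hchain (Real.exp_pos (2 * m * t)).le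
    have e1 : K * Real.exp (-(m * t)) * Real.exp (2 * m * t) = K * Real.exp (m * t) := by
      rw [mul_assoc, ← Real.exp_add]
      congr 1
      congr 1
      ring
    have e2 : P * Real.exp (2 * m) * Real.exp (-(2 * m * t)) * Real.exp (2 * m * t) =
        P * Real.exp (2 * m) := by
      rw [mul_assoc, ← Real.exp_add, neg_add_cancel, Real.exp_zero, mul_one]
    rw [e1, e2] at hmul
    exact hmul
  have hmt : Real.exp (m * t) ≤ P * Real.exp (2 * m) / K := by
    rw [le_div_iff₀ hKpos, mul_comm]
    exact h3
  linarith [ht.1]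

/-- The probe `φ(x) = exp(−2 x₊)` is continuous. -/
theorem continuous_probe : Continuous fun x : ℝ => Real.exp (-2 * max x 0) := by
  fun_prop

/-- The probe is bounded by `1`. -/
theorem abs_probe_le (x : ℝ) : |Real.exp (-2 * max x 0)| ≤ 1 := by
  rw [abs_of_pos (Real.exp_pos _)]
  apply Real.exp_le_one_iff.2
  have : 0 ≤ max x 0 := le_max_right _ _
  linarith

end Reduction

/-- **The crux `EquipartitionPinsProbe` reduces to the local free-gluon law** (line `Sketch` of
crux `stmt-QuantumFields-8760`, closed modulo its one physics stub `stub_localLaw`): IF uniform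
equipartition of the plaquette energy over torus-limit states forces, for some `D ≥ 1`, the
time-covariances of the probe `exp(−2β(N − Re tr r(U_p)))` to converge uniformly over torus-limit
states to the covariance of `e^{−|Y_{p₀}|²}`, `e^{−|Y_{p_n}|²}` under `curvatureGaussianField 4 D`,
THEN the crux holds — with probe `φ(x) = e^{−2x₊}` and profile `g_D(n) = 2^{−D}((1 − c_n²)^{−D/2} − 1)`
(stubs `stub_equipartition`, `stub_gaussianProfile`, `stub_secondDifference`, `stub_poissonIntegral`,
`stub_axisFourier`, `stub_profile`, all landed, and the glue of namespace `Reduction`). -/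
theorem equipartitionPinsProbe_of_localLaw :
    (∀ (G : Type) [Group G] [TopologicalSpace G] [IsTopologicalGroup G] [CompactSpace G],
      Literature.MathematicalPhysics.QuantumFieldTheory.IsCompactSimpleLieGroup G →
      letI : MeasurableSpace G := borel G
      haveI : BorelSpace G := ⟨rfl⟩
      ∀ r : Literature.MathematicalPhysics.QuantumFieldTheory.LatticeRep G,
      (∀ ε : ℝ, 0 < ε → ∀ᶠ β : ℝ in Filter.atTop,
      ∀ μ ∈ Literature.MathematicalPhysics.QuantumLattice.infiniteVolumeLimitPoints
      (d := 4) r.ρ β,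
      |β * (∫ U, (∑ i : Fin 4, ∑ j : Fin 4,
      if i < j then ((r.N : ℝ) -
      Literature.MathematicalPhysics.QuantumLattice.plaquetteObs r.ρ 0 i j U) else 0) ∂μ) -
      3 * (Module.finrank ℝ ↥(Submodule.span ℝ {X : Matrix (Fin r.N) (Fin r.N) ℂ |
      ∀ t : ℝ, NormedSpace.exp ((t : ℂ) • X) ∈ Set.range r.ρ}) : ℝ) / 2| < ε) →
      ∃ D : ℕ, 0 < D ∧
      ∀ (n : ℕ) (ε : ℝ), 0 < ε → ∀ᶠ β : ℝ in Filter.atTop,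
      ∀ μ ∈ Literature.MathematicalPhysics.QuantumLattice.infiniteVolumeLimitPoints
      (d := 4) r.ρ β,
      |(∫ U, Real.exp (-2 * max (β * ((r.N : ℝ) -
      Literature.MathematicalPhysics.QuantumLattice.plaquetteObs r.ρ 0 1 2 U)) 0) *
      Real.exp (-2 * max (β * ((r.N : ℝ) -
      Literature.MathematicalPhysics.QuantumLattice.plaquetteObs r.ρ 0 1 2
      (Literature.MathematicalPhysics.QuantumLattice.configShift
      (-(Pi.single 0 (n : ℤ))) U))) 0) ∂μ) -
      (∫ U, Real.exp (-2 * max (β * ((r.N : ℝ) -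
      Literature.MathematicalPhysics.QuantumLattice.plaquetteObs r.ρ 0 1 2 U)) 0) ∂μ) *
      (∫ U, Real.exp (-2 * max (β * ((r.N : ℝ) -
      Literature.MathematicalPhysics.QuantumLattice.plaquetteObs r.ρ 0 1 2
      (Literature.MathematicalPhysics.QuantumLattice.configShift
      (-(Pi.single 0 (n : ℤ))) U))) 0) ∂μ) -
      ((∫ Y, Real.exp (-(∑ a : Fin D,
      (Y (Literature.MathematicalPhysics.QuantumFieldTheory.plaquette12 (d := 4)
      (by norm_num) 0) a) ^ 2)) *
      Real.exp (-(∑ a : Fin D,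
      (Y (Literature.MathematicalPhysics.QuantumFieldTheory.plaquette12 (d := 4)
      (by norm_num) (Pi.single (0 : Fin 4) (n : ℤ) :
      Literature.Probability.LatticeModels.Site 4)) a) ^ 2))
      ∂(Literature.MathematicalPhysics.QuantumFieldTheory.curvatureGaussianField 4 D)) -
      (∫ Y, Real.exp (-(∑ a : Fin D,
      (Y (Literature.MathematicalPhysics.QuantumFieldTheory.plaquette12 (d := 4)
      (by norm_num) 0) a) ^ 2))
      ∂(Literature.MathematicalPhysics.QuantumFieldTheory.curvatureGaussianField 4 D)) *
      (∫ Y, Real.exp (-(∑ a : Fin D,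
      (Y (Literature.MathematicalPhysics.QuantumFieldTheory.plaquette12 (d := 4)
      (by norm_num) (Pi.single (0 : Fin 4) (n : ℤ) :
      Literature.Probability.LatticeModels.Site 4)) a) ^ 2))
      ∂(Literature.MathematicalPhysics.QuantumFieldTheory.curvatureGaussianField 4 D)))| < ε) →
    Summit.QuantumFields.YangMills.Theses.EquipartitionCriticality.EquipartitionPinsProbe := by
  intro hlocal G _ _ _ _ hG r hK
  obtain ⟨D, hD, hlim⟩ := hlocal G hG r (stub_equipartition G hG r hK)
  refine ⟨fun x => Real.exp (-2 * max x 0), Reduction.continuous_probe, ⟨1, Reduction.abs_probe_le⟩,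
    fun n => (2 : ℝ) ^ (-(D : ℝ)) *
      ((1 - curvaturePlaquetteCorr (d := 4) Reduction.three_le_four (n : ℤ) ^ 2) ^ (-((D : ℝ) / 2)) - 1),
    Reduction.clause_of_bounds hD
      (fun n => curvaturePlaquetteCorr (d := 4) Reduction.three_le_four (n : ℤ)) _
      (fun n hn => Reduction.corr_pos (by exact_mod_cast hn))
      (fun n hn => Reduction.corr_le (by exact_mod_cast hn))
      (fun ε hε => Reduction.corr_subexp hε) (fun n => rfl), ?_⟩
  intro n ε hε
  beta_reduce
  have hg := stub_gaussianProfile D n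
  rw [show curvaturePlaquetteCorr (d := 4) Reduction.three_le_four (n : ℤ) =
      curvaturePlaquetteCorr (d := 4) (by norm_num) (n : ℤ) from rfl, ← hg]
  exact hlim n ε hε

end Summit.QuantumFields.YangMills.Theorems.EquipartitionPinsProbe

end
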